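import Literature.NumberTheory.Automorphic.AsaiAtOneOfL2
import Literature.NumberTheory.Automorphic.AutomorphicRepsGLSatakeDictionaryHolds
import Literature.NumberTheory.Automorphic.AutomorphicRepsGLAssociatedL2Holds
import Literature.NumberTheory.Automorphic.TwistedAsaiPole
import HarnessLib

/-!
# Grbac–Shahidi 2015, Thm. 4.3 at `s = 1`, from the HOLOMORPHY of the Asai `L`-functions
# (Thm. 4.3 (1), (2)(a)) in `L²_cusp` and the `L²` facts of Jacquet–Shalika

Topic `NumberTheory/Automorphic`; namespace `Literature.NumberTheory.Automorphic`. Proof file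
(theorems only: no definition, no named fact, no instance), fourth sibling of
`AsaiSignContinuation` (the named fact `GrbacShahidi2015_partialAsaiL_at_one`), continuing
`AsaiAtOneOfL2` (`GrbacShahidi2015_partialAsaiL_at_one_of_holomorphy_of_L2`: the fact from a
holomorphy hypothesis `hHol` at EVERY Asai datum of every cuspidal Borel–Jacquet datum `Π`, plus the
tree's `L²` named facts of Jacquet–Shalika and `multiplicity_one_gl`).

## What is proved

The hypothesis `hHol` of `…_of_holomorphy_of_L2` is stated for Borel–Jacquet data
`Π : CuspidalAutomorphicRepData N E hcpt` with ARBITRARY behaviour on `A_G` (unitary a.e.: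
`Π = Π₁ ⊗ |det|^{z}`, `Re z = 0`, with `Π₁` normalised as in Grbac–Shahidi, §2.A p. 190: "We always
assume that `Σ` is irreducible unitary and trivial on `A_P(F_∞)°` … just a convenient normalization,
obtained by twisting by a unitary character"), at every Asai datum `(S, A)`, and asks for a
continuation of `(s - 1) L^S(s, Π, As^η)` to `{1 < Re s} ∪ B(1, δ)` vanishing at `1` unless `Π` is
conjugate self-dual a.e.  Here it is DERIVED from the printed theorem in the printed normalisation —
Grbac–Shahidi 2015, Thm. 4.3 (1) "If `σ` is not Galois self-dual … `L(s, σ, r_A)` is entire" and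
(2)(a) "`L(s, σ, r_A)` is entire, except for possible simple poles at `s = 0` and `s = 1`", for the
Asai and the twisted Asai `L`-function (`L(s, σ, r_A ⊗ δ_{E/F}) = L(s, σ ⊗ δ̂, r_A)`, p. 206), in
partial form (finitely many reciprocal local factors are entire) and in the tree's `L²` currency
`CuspidalAutomorphicRepGL N E μ = {Π ≤ L²_cusp(GL_N(E) A_G \ GL_N(𝔸_E))}` (representations trivial on
`A_G`, i.e. EXACTLY the printed normalisation; cf. the module docstring of `PairLFunctionPoles`,
item 2) — the hypothesis `hGS` below, which is REQUESTED as the cite item / named fact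
`GrbacShahidi2015_partialAsaiL_holomorphy` (a proving seat may not file a new named fact, D-0026; the
statement is `hGS` verbatim, [cite: GrbacShahidi2015, Thm. 4.3 (1), (2)(a)]) — as follows
(`CuspidalAutomorphicRepData.hol_of_asaiHolomorphyL2`):

1. **Borel–Jacquet 5.7 at every place.** By the POINTWISE dictionary of the tree
   (`CuspidalAutomorphicRepData.exists_satake_eq_cpow_mul_L2_pointwise` over the theorems
   `AutomorphicRepsGL.exists_isAssociatedL2_holds`, `hasSatakeParamAt_iff_L2_holds` and the clean
   model `exists_clean_hasSatakeParamAt_iff_of_sSup_irreducible`), there are `z ∈ ℂ` and a cuspidal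
   `Π₀ ≤ L²_cusp(μ)` such that at EVERY finite place `w`, `β` is a Satake parameter of `Π` at `w` iff
   `q_w^{-z} β` is one of `Π₀` at `w` in the `L²` sense. Hence for EVERY Asai datum `(S, A)` of `Π`
   the shifted family `A' = q^{-z} A` is an `L²` Satake family of `Π₀` off `S_E` for the SAME `S` —
   no enlargement of `S`, so no transport and no non-vanishing of removed local factors is needed
   (contrast `AsaiSignContProofsL2`, hypothesis `hNV`).
2. `Re z = 0` by unitarity a.e. at one place (`re_eq_zero_of_norm_prod_eq_one_of_shift`), and
   `L^S(s, Π, As^η) = L^S(s - 2z, Π₀, As^η)` factor by factor (`partialAsaiL_eq_of_shift`: at an inert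
   `v`, `q_w = q_v²` and `P^η(q_w^z α)(q_v^{-s}) = P^η(α)(q_v^{2z - s})`,
   `eval_asaiInertPolynomial_map_mul`; at a split `v`, `q_w = q_{w̄} = q_v`,
   `eval_satakePairPolynomial_map_mul_map_mul`).
3. With `G` entire, `G = s (s - 1) L^S(s, Π₀, As^η)` far to the right (`hGS`): if `z ≠ 0`,
   `G_Π(s) = (s - 1) G(s - 2z) / ((s - 2z)(s - 2z - 1))` is holomorphic on `{1 < Re s} ∪ B(1, δ)`,
   `δ = min 1 |2z|` (the possible pole `1 + 2z` of `L^S(s, Π, As^η)` lies on `Re s = 1` at distance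
   `|2z| ≥ δ` from `1`, the possible pole `2z` on `Re s = 0`), equals `(s - 1) L^S(s, Π, As^η)` far to
   the right and vanishes at `1`; if `z = 0`, `G_Π = G / s` is holomorphic off `0`, equals
   `(s - 1) L^S` far to the right, and if `Π` is not conjugate self-dual a.e. then neither is the
   family `A' = A` (uniqueness of Satake parameters, `hasSatakeParamAt_unique_holds`), so by (1) `L^S`
   is the restriction of an entire `H`, `G = s (s - 1) H` identically (identity theorem), `G_Π(1) = 0`.

4. **The weak form: holomorphy on `Re(s) ≥ 1` only (§ `ReGeOne`).**  The fact at `s = 1` needs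
   NOTHING inside the critical strip: it already follows (same four `L²` facts) from the hypothesis
   `hGSw` that `(s - 1) L^S(s, Π₀, As^η)` continues holomorphically to some OPEN NEIGHBOURHOOD `U` of
   the CLOSED half-plane `{1 ≤ Re s}` (both signs), with value `0` at `s = 1` unless the family is
   conjugate self-dual a.e. — Grbac–Shahidi's Thm. 4.3 (1), (2)(a) restricted to `Re(s) ≥ 1`, which is
   the part of the theorem the authors obtain WITHOUT the endoscopic classification (Remark 4.2 and
   §4.A: for `σ` not Galois self-dual the Eisenstein series is holomorphic for `Re(s) > 0` by
   Harish-Chandra's criterion, Mœglin–Waldspurger IV.3.12, whence `L(z, σ, r_A)` is holomorphic for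
   `Re(z) > 0` by Thm. 2.1 and the argument of p. 205; §4.C: for Galois self-dual `σ` Kim's unitarity
   argument gives the Eisenstein series on `Re(s) ≥ 1/2` up to a simple pole at `s = 1/2`, whence
   `L(z, σ, r_A)` on `Re(z) ≥ 1` up to a simple pole at `z = 1`, pp. 205–207), and, for the partial
   `As⁺` function, Flicker's Rankin–Selberg theorem (Flicker 1988, Theorem p. 297: "The only possible
   pole of `L(s, r(π), V)` in `Re s ≥ 1` is simple, located at `s = 1`"; Flicker–Zinoviev 1995 for
   every quadratic extension).  With `U ∋ 1 - 2z` open, `G_Π(s) = (s - 1) G(s - 2z) / (s - 2z - 1)` is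
   holomorphic on `{1 < Re s} ∪ B(1, δ)` for `δ = min ε |2z|`, `B(1 - 2z, ε) ⊆ U` (`z ≠ 0`), resp.
   `G_Π = G` on `{1 < Re s} ∪ B(1, ε) ⊆ U` (`z = 0`) — no identity theorem is needed.  The strong
   (entire) form `hGS` implies `hGSw` with `U = ℂ ∖ {0}`, `G / s`
   (`asaiHolomorphyReGeOne_of_asaiHolomorphy`), so item 3 is recovered.

Results:

* `asaiEulerFactor_eq_of_shift`, `partialAsaiL_eq_of_shift` — the Asai products of shifted families;
* `CuspidalAutomorphicRepData.hol_of_asaiHolomorphyL2` — `hHol` at one datum from `hGS`;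
* `GrbacShahidi2015_partialAsaiL_at_one_of_asaiHolomorphy_of_L2` — **the named fact
  `GrbacShahidi2015_partialAsaiL_at_one` from `hGS` (Grbac–Shahidi, Thm. 4.3 (1), (2)(a), partial
  form, `L²` currency) and the named facts `JacquetShalika1981_partialPairL_at_one_of_ne_conj`,
  `JacquetShalika1981_partialPairL_boundary_of_ne_one`, `JacquetShalika1981_partialPairL_pole_of_eq_conj`,
  `multiplicity_one_gl`** — so that, once `hGS` is filed as a named fact, EVERY hypothesis is a
  declaration of the tree;
* `CuspidalAutomorphicRepData.hol_of_asaiHolomorphyReGeOneL2`, `asaiHolomorphyReGeOne_of_asaiHolomorphy`,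
  `GrbacShahidi2015_partialAsaiL_at_one_of_asaiHolomorphyReGeOne_of_L2` — **the same from the WEAK
  form `hGSw` (holomorphy of `(s - 1) L^S(s, Π₀, As^η)` on a neighbourhood of `{1 ≤ Re s}` only:
  Grbac–Shahidi Thm. 4.3 for `Re(s) ≥ 1`, Remark 4.2 / §4.C; Flicker 1988, Flicker–Zinoviev 1995)**,
  the statement requested as the named fact `GrbacShahidi2015_partialAsaiL_holomorphy_re_ge_one`
  (`hGSw` verbatim).

What this does NOT give: `hGS` / `hGSw` themselves (Langlands–Shahidi theory on `U(n, n)` — for the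
weak form without Mok's classification —, resp. Flicker's Rankin–Selberg integrals for the partial
`As⁺` function), the three `L²` facts and multiplicity one.

## References

* N. Grbac, F. Shahidi, *Endoscopic transfer for unitary groups and holomorphy of Asai
  `L`-functions*, Pacific J. Math. 276 (2015), 185–211: §2.A (p. 190, normalisation; p. 191, the
  `L`-functions), Thm. 4.3 (pp. 186, 204) and its proof, pp. 204–206 (identity `(∗∗)` and
  `L(s, σ, r_A ⊗ δ_{E/F}) = L(s, σ ⊗ δ̂, r_A)`, p. 206; Remarks 4.2, 4.4; §4.A p. 204 and §4.C
  pp. 206–207, the parts independent of the endoscopic classification). [GrbacShahidi2015]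
* Y. Z. Flicker, *Twisted tensors and Euler products*, Bull. Soc. Math. France 116 (1988), 295–313,
  Theorem p. 297. [Flicker1988]
* Y. Z. Flicker, D. Zinoviev, *On poles of twisted tensor `L`-functions*, Proc. Japan Acad. Ser. A
  71 (1995), 114–116, Theorem. [FlickerZinoviev1995]
* J. Arthur, L. Clozel, *Simple algebras, base change, and the advanced theory of the trace formula*,
  Ann. of Math. Stud. 120 (1989), Ch. 3 §2 (2.1)–(2.3). [ArthurClozelAMS120]
* A. Borel, H. Jacquet, *Automorphic forms and automorphic representations*, Corvallis 1979, 4.6, 5.7.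
  [BorelJacquetCorvallis1979]
-/

noncomputable section

open scoped Topology
open NumberField IsDedekindDomain Filter Polynomial MeasureTheory

namespace Literature.NumberTheory.Automorphic

/-! ### Asai products of shifted families -/

section Shift

variable {F E : Type} [Field F] [NumberField F] [Field E] [NumberField E] [Algebra F E]

/-- **The Asai Euler factors of a shifted family.** If `A w = q_w^{z} A₀ w` above the complement of
`S` (with the `c`-fixed places there inert), then factor by factor
`det(1 - As^η(t_v) q_v^{-s}) = det(1 - As^η(t₀,v) q_v^{-(s - 2z)})`: at an inert `v`, `q_w = q_v²` and
`P^η(q_w^z α)(x) = P^η(α)(q_w^z x)` (`eval_asaiInertPolynomial_map_mul`) with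
`q_w^z q_v^{-s} = q_v^{2z - s}`; at a split `v`, `q_w = q_{c • w} = q_v` and
`det(1 - q_v^z α ⊗ q_v^z β x) = det(1 - α ⊗ β q_v^{2z} x)` (`eval_satakePairPolynomial_map_mul_map_mul`).
That is, `L_v(s, (Π₀ ⊗ |det|^{z})_v, As^η) = L_v(s - 2z, Π₀,v, As^η)` ("both tensor factors carry
`q^{-it₀}`", docstring of `GrbacShahidi2015_partialAsaiL_at_one`). [folklore] -/
theorem asaiEulerFactor_eq_of_shift (h2 : Module.finrank F E = 2) {c : E ≃ₐ[F] E}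
    {S : Set (HeightOneSpectrum (𝓞 F))} {A A₀ : SatakeFamily E} {z : ℂ}
    (hA : ∀ w : HeightOneSpectrum (𝓞 E), w.under (𝓞 F) ∉ S →
      A w = (A₀ w).map (((w.residueCard : ℂ) ^ z) * ·))
    (hinert : ∀ w : HeightOneSpectrum (𝓞 E), w.under (𝓞 F) ∉ S → c • w = w →
      w.asIdeal.inertiaDeg (𝓞 F) = 2)
    (η : ℤˣ) (s : ℂ) :
    (fun v : {v : HeightOneSpectrum (𝓞 F) // v ∉ S} =>
        ((asaiLocalPolynomial c A η (placeAbove E v.1)).eval ((v.1.residueCard : ℂ) ^ (-s)))⁻¹) =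
      fun v : {v : HeightOneSpectrum (𝓞 F) // v ∉ S} =>
        ((asaiLocalPolynomial c A₀ η (placeAbove E v.1)).eval
          ((v.1.residueCard : ℂ) ^ (-(s - (z + z)))))⁻¹ := by
  funext v
  set w₀ := placeAbove E v.1 with hw₀
  have hw₀v : w₀.under (𝓞 F) = v.1 := placeAbove_under v.1
  have hw₀S : w₀.under (𝓞 F) ∉ S := by
    rw [hw₀v]
    exact v.2
  have hq : v.1.residueCard ≠ 0 := by
    have := v.1.one_lt_residueCard
    omega
  have hq' : (v.1.residueCard : ℂ) ≠ 0 := Nat.cast_ne_zero.mpr hq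
  by_cases hfix : c • w₀ = w₀
  · -- inert: `q_{w₀} = q_v²`
    have hqw := residueCard_eq_pow_inertiaDeg (F := F) w₀
    rw [hinert w₀ hw₀S hfix, hw₀v] at hqw
    rw [asaiLocalPolynomial_of_smul_eq A η hfix, asaiLocalPolynomial_of_smul_eq A₀ η hfix,
      hA w₀ hw₀S, eval_asaiInertPolynomial_map_mul, hqw, Nat.cast_pow,
      ← Complex.natCast_cpow_natCast_mul, ← Complex.cpow_add _ _ hq']
    congr 3
    push_cast
    ring
  · -- split: `q_{w₀} = q_{c • w₀} = q_v`
    have hcw₀S : (c • w₀).under (𝓞 F) ∉ S := by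
      rw [HeightOneSpectrum.under_algEquiv_smul F E c w₀]
      exact hw₀S
    have hq₀ := residueCard_eq_pow_inertiaDeg (F := F) w₀
    rw [HeightOneSpectrum.inertiaDeg_eq_one_of_smul_ne h2 hfix, pow_one, hw₀v] at hq₀
    have hq₁ : (c • w₀).residueCard = v.1.residueCard := by
      rw [residueCard_smul F c w₀, hq₀]
    rw [asaiLocalPolynomial_of_smul_ne A η hfix, asaiLocalPolynomial_of_smul_ne A₀ η hfix,
      hA w₀ hw₀S, hA (c • w₀) hcw₀S, hq₀, hq₁, eval_satakePairPolynomial_map_mul_map_mul,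
      natCast_cpow_mul_cpow_mul_cpow_neg _ hq]

/-- **`L^S(s, Π₀ ⊗ |det|^{z}, As^η) = L^S(s - 2z, Π₀, As^η)`** for families shifted as in
`asaiEulerFactor_eq_of_shift`, identically in `s` (both sides are the same `tprod`). [folklore] -/
theorem partialAsaiL_eq_of_shift (h2 : Module.finrank F E = 2) {c : E ≃ₐ[F] E}
    {S : Set (HeightOneSpectrum (𝓞 F))} {A A₀ : SatakeFamily E} {z : ℂ}
    (hA : ∀ w : HeightOneSpectrum (𝓞 E), w.under (𝓞 F) ∉ S →
      A w = (A₀ w).map (((w.residueCard : ℂ) ^ z) * ·))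
    (hinert : ∀ w : HeightOneSpectrum (𝓞 E), w.under (𝓞 F) ∉ S → c • w = w →
      w.asIdeal.inertiaDeg (𝓞 F) = 2)
    (η : ℤˣ) :
    partialAsaiL S c A η = fun s => partialAsaiL S c A₀ η (s - (z + z)) := by
  funext s
  simp only [partialAsaiL]
  exact congrArg tprod (asaiEulerFactor_eq_of_shift h2 hA hinert η s)

end Shift

/-! ### The holomorphy hypothesis `hHol` from Grbac–Shahidi's Thm. 4.3 (1), (2)(a) in `L²_cusp` -/

section Reduction

open AdelicGroupData

variable {F E : Type} [Field F] [NumberField F] [Field E] [NumberField E] [Algebra F E]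

/-- Two entire functions that agree on a right half-plane agree everywhere (identity theorem on the
connected plane). [folklore] -/
theorem eq_of_differentiable_of_eq_on_lt_re {f g : ℂ → ℂ} (hf : Differentiable ℂ f)
    (hg : Differentiable ℂ g) {σ : ℝ} (h : ∀ s : ℂ, σ < s.re → f s = g s) : f = g := by
  have hfa : AnalyticOnNhd ℂ f Set.univ := hf.differentiableOn.analyticOnNhd isOpen_univ
  have hga : AnalyticOnNhd ℂ g Set.univ := hg.differentiableOn.analyticOnNhd isOpen_univ
  refine hfa.eq_of_eventuallyEq hga (z₀ := ((σ + 1 : ℝ) : ℂ)) ?_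
  have hopen : IsOpen {s : ℂ | σ < s.re} := isOpen_lt continuous_const Complex.continuous_re
  have hmem : ((σ + 1 : ℝ) : ℂ) ∈ {s : ℂ | σ < s.re} := by
    show σ < ((σ + 1 : ℝ) : ℂ).re
    rw [Complex.ofReal_re]
    linarith
  exact Filter.eventually_of_mem (hopen.mem_nhds hmem) fun s hs => h s hs

/-- **`hHol` at one datum from Grbac–Shahidi's Thm. 4.3 (1), (2)(a) in `L²_cusp`** (module
docstring, steps 1–3). For a cuspidal Borel–Jacquet datum `Π` on `GL_N(𝔸_E)` (`N ≥ 1`), unitary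
a.e., an Asai datum `(S, A)` and a sign `η`: granted `hGS` — for every cuspidal
`Π₀ ≤ L²_cusp(GL_N(E) A_G \ GL_N(𝔸_E))`, every finite `S`, every `L²` Satake family `A'` of `Π₀` off
`S_E` with the `c`-fixed places off `S` inert, and every sign, `s (s - 1) L^S(s, Π₀, As^η)` is the
restriction to a right half-plane of an entire function, and so is `L^S(s, Π₀, As^η)` itself unless
`A'` is conjugate self-dual a.e. (Grbac–Shahidi 2015, Thm. 4.3 (2)(a) and (1), both signs via
`L(s, σ, r_A ⊗ δ_{E/F}) = L(s, σ ⊗ δ̂, r_A)`, partial form) — the function `(s - 1) L^S(s, Π, As^η)`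
continues holomorphically from some `{σ₀ < Re s}` to `{1 < Re s} ∪ B(1, δ)`, with value `0` at `1`
unless `Π` is conjugate self-dual a.e.  Proof: pointwise Borel–Jacquet dictionary `t_{Π,w} = q_w^z t_{Π₀,w}`
at every `w` (so `A' = q^{-z} A` is a family of `Π₀` off `S_E` for the same `S`), `Re z = 0`,
`L^S(s, Π, As^η) = L^S(s - 2z, Π₀, As^η)`, and the explicit continuations of step 3.
[cite: GrbacShahidi2015, Thm. 4.3 (1), (2)(a), §2.A p. 190, p. 206]
[cite: BorelJacquetCorvallis1979, 4.6, 5.7] -/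
theorem CuspidalAutomorphicRepData.hol_of_asaiHolomorphyL2
    (hGS : ∀ (F E : Type) [Field F] [NumberField F] [Field E] [NumberField E] [Algebra F E]
      (c : E ≃ₐ[F] E), Module.finrank F E = 2 → c ≠ 1 →
      ∀ (N : ℕ) (μ : Measure (gl N E).automorphicQuotient) [(gl N E).IsAutomorphicMeasure μ]
        (P : CuspidalAutomorphicRepGL N E μ), 0 < N →
        ∀ (S : Set (HeightOneSpectrum (𝓞 F))) (A : SatakeFamily E) (η : ℤˣ), S.Finite →
          IsSatakeFamilyOf P {w : HeightOneSpectrum (𝓞 E) | w.under (𝓞 F) ∈ S} A →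
          (∀ w : HeightOneSpectrum (𝓞 E), w.under (𝓞 F) ∉ S → c • w = w →
            w.asIdeal.inertiaDeg (𝓞 F) = 2) →
          ∃ σ₀ : ℝ, 1 ≤ σ₀ ∧
            (∃ G : ℂ → ℂ, Differentiable ℂ G ∧
              ∀ s : ℂ, σ₀ < s.re → G s = s * (s - 1) * partialAsaiL S c A η s) ∧
            ((¬ ∀ᶠ w : HeightOneSpectrum (𝓞 E) in cofinite, A (c • w) = (A w).map (·⁻¹)) →
              ∃ H : ℂ → ℂ, Differentiable ℂ H ∧
                ∀ s : ℂ, σ₀ < s.re → H s = partialAsaiL S c A η s))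
    (h2 : Module.finrank F E = 2) {c : E ≃ₐ[F] E} (hc : c ≠ 1) {N : ℕ}
    {hcpt : isCompact_glFiniteIntegralLevel N E} (π : CuspidalAutomorphicRepData N E hcpt)
    (hN : 0 < N)
    (hu : ∀ᶠ w : HeightOneSpectrum (𝓞 E) in cofinite, ∀ α : Multiset ℂ,
      π.1.HasSatakeParamAt w α → ‖α.prod‖ = 1)
    {S : Set (HeightOneSpectrum (𝓞 F))} {A : SatakeFamily E} (η : ℤˣ)
    (hSA : π.1.IsAsaiDatum c S A) :
    ∃ σ₀ : ℝ, 1 ≤ σ₀ ∧ ∃ δ : ℝ, 0 < δ ∧ ∃ G : ℂ → ℂ,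
      DifferentiableOn ℂ G ({s : ℂ | 1 < s.re} ∪ Metric.ball 1 δ) ∧
      (∀ s : ℂ, σ₀ < s.re → G s = (s - 1) * partialAsaiL S c A η s) ∧
      (¬ π.1.IsConjSelfDualAE c → G 1 = 0) := by
  classical
  haveI : NeZero N := ⟨hN.ne'⟩
  haveI := infinite_heightOneSpectrum E
  obtain ⟨μ, hμ⟩ := AdelicGroupData.exists_isAutomorphicMeasure_gl_holds (n := N) (K := E)
  haveI := hμ
  -- Step 1: the pointwise Borel–Jacquet dictionary `t_{Π,w} = q_w^z t_{Π₀,w}` at every place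
  obtain ⟨π₀, h0W', h0π⟩ :=
    CuspidalAutomorphicRepData.exists_clean_hasSatakeParamAt_iff_of_sSup_irreducible
      (AutomorphicRepsGL.stable_cuspidal_eq_sSup_irreducible_holds (hcpt := hcpt)) π
  obtain ⟨z, P, S₁, αP, -, -, -, hdict⟩ :=
    CuspidalAutomorphicRepData.exists_satake_eq_cpow_mul_L2_pointwise
      (AutomorphicRepsGL.exists_isAssociatedL2_holds hcpt μ) (hasSatakeParamAt_iff_L2_holds hcpt μ)
      π π₀ h0W' h0π
  set SE : Set (HeightOneSpectrum (𝓞 E)) := {w | w.under (𝓞 F) ∈ S} with hSE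
  have hSEfin : SE.Finite := finite_setOf_under_mem hSA.finite
  -- the shifted family `A' = q^{-z} A` is an `L²` Satake family of `Π₀` off `S_E`, for the SAME `S`
  set A' : SatakeFamily E := fun w => (A w).map (((w.residueCard : ℂ) ^ (-z)) * ·) with hA'
  have hA'fam : IsSatakeFamilyOf P SE A' := by
    intro w hw
    obtain ⟨𝔫, ϖ, h𝔫, hw𝔫, hSat⟩ := (hdict w (A w)).mp (hSA.hasSatakeParamAt hw)
    exact ⟨𝔫, h𝔫, hw𝔫, ϖ, hSat⟩
  have hAA' : ∀ w : HeightOneSpectrum (𝓞 E), w.under (𝓞 F) ∉ S →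
      A w = (A' w).map (((w.residueCard : ℂ) ^ z) * ·) := by
    intro w _
    simp only [hA', Multiset.map_map, Function.comp_def, residueCard_cpow_mul_cpow_neg_mul,
      Multiset.map_id']
  -- Step 2: `Re z = 0` by unitarity at one place outside `S_E`
  have hz : z.re = 0 := by
    have hev : ∀ᶠ w : HeightOneSpectrum (𝓞 E) in cofinite, w ∉ SE := hSEfin.compl_mem_cofinite
    obtain ⟨w₀, hw₀u, hw₀⟩ := (hu.and hev).exists
    exact re_eq_zero_of_norm_prod_eq_one_of_shift hA'fam hN hw₀ (hAA' w₀ hw₀)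
      (hw₀u (A w₀) (hSA.hasSatakeParamAt hw₀))
  have hzz : (z + z).re = 0 := by rw [Complex.add_re, hz, add_zero]
  have hre : ∀ s : ℂ, (s - (z + z)).re = s.re := fun s => by
    rw [Complex.sub_re, hzz, sub_zero]
  -- the fact at `(Π₀, S, A', η)` and the shift `L^S(s, Π, As^η) = L^S(s - 2z, Π₀, As^η)`
  have hinert : ∀ w : HeightOneSpectrum (𝓞 E), w.under (𝓞 F) ∉ S → c • w = w →
      w.asIdeal.inertiaDeg (𝓞 F) = 2 := fun w hw hcw => hSA.inertiaDeg_eq_two hw hcw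
  obtain ⟨σ₀, hσ₀, ⟨G, hG, hGL⟩, hnc⟩ := hGS F E c h2 hc N μ P hN S A' η hSA.finite hA'fam hinert
  have hshift : partialAsaiL S c A η = fun s => partialAsaiL S c A' η (s - (z + z)) :=
    partialAsaiL_eq_of_shift h2 hAA' hinert η
  -- Step 3: the explicit continuations
  by_cases hz0 : z + z = 0
  · -- `z = 0`: `G_Π = G / s`
    refine ⟨σ₀, hσ₀, 1, one_pos, fun s => G s / s, ?_, ?_, ?_⟩
    · intro s hs
      have hs0 : s ≠ 0 := by
        rintro rfl
        rcases hs with hs | hs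
        · simp only [Set.mem_setOf_eq, Complex.zero_re] at hs
          linarith
        · simp only [Metric.mem_ball, dist_zero_left, norm_one, lt_self_iff_false] at hs
      exact ((hG s).div (differentiableAt_id) hs0).differentiableWithinAt
    · intro s hs
      have hs0 : s ≠ 0 := by
        intro h
        rw [h, Complex.zero_re] at hs
        linarith
      show G s / s = (s - 1) * partialAsaiL S c A η s
      rw [hGL s hs, hshift, hz0]
      simp only [sub_zero]
      rw [mul_assoc, mul_div_cancel_left₀ _ hs0]
    · intro hπ
      have hz' : z = 0 := add_self_eq_zero.mp hz0
      have hA'A : ∀ w, A' w = A w := fun w => by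
        simp only [hA', hz', neg_zero, Complex.cpow_zero, one_mul, Multiset.map_id']
      -- `A'` is not conjugate self-dual a.e., since `Π` is not
      have hncsd : ¬ ∀ᶠ w : HeightOneSpectrum (𝓞 E) in cofinite, A' (c • w) = (A' w).map (·⁻¹) := by
        intro hcsd
        apply hπ
        have hev : ∀ᶠ w : HeightOneSpectrum (𝓞 E) in cofinite, w ∉ SE := hSEfin.compl_mem_cofinite
        filter_upwards [hcsd, hev] with w hw hwS α β hα hβ
        have hcwS : (c • w).under (𝓞 F) ∉ S := by
          rw [HeightOneSpectrum.under_algEquiv_smul F E c w]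
          exact hwS
        rw [π.1.hasSatakeParamAt_unique_holds hα (hSA.hasSatakeParamAt hwS),
          π.1.hasSatakeParamAt_unique_holds hβ (hSA.hasSatakeParamAt hcwS), ← hA'A w,
          ← hA'A (c • w)]
        exact hw
      obtain ⟨H, hH, hHL⟩ := hnc hncsd
      -- `G = s (s - 1) H` identically
      have hGH : G = fun s => s * (s - 1) * H s :=
        eq_of_differentiable_of_eq_on_lt_re hG
          ((differentiable_id.mul (differentiable_id.sub_const 1)).mul hH)
          (fun s hs => by rw [hGL s hs, hHL s hs])
      show G 1 / 1 = 0
      rw [hGH]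
      simp
  · -- `z ≠ 0`: `G_Π(s) = (s - 1) G(s - 2z) / ((s - 2z) (s - 2z - 1))`, `δ = min 1 |2z|`
    set δ : ℝ := min 1 ‖z + z‖ with hδ
    have hδpos : 0 < δ := lt_min one_pos (norm_pos_iff.mpr hz0)
    -- the denominators do not vanish on `{1 < Re s} ∪ B(1, δ)`
    have hden : ∀ s : ℂ, s ∈ {s : ℂ | 1 < s.re} ∪ Metric.ball 1 δ →
        (s - (z + z)) * (s - (z + z) - 1) ≠ 0 := by
      intro s hs
      rcases hs with hs | hs
      · have hs' : 1 < s.re := hs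
        refine mul_ne_zero ?_ ?_
        · intro h
          have := congrArg Complex.re h
          rw [hre, Complex.zero_re] at this
          linarith
        · intro h
          have := congrArg Complex.re h
          rw [Complex.sub_re, hre, Complex.one_re, Complex.zero_re] at this
          linarith
      · have hs' : dist s 1 < δ := hs
        refine mul_ne_zero ?_ ?_
        · intro h
          have hsz : s = z + z := sub_eq_zero.mp h
          have h1 : dist s 1 < 1 := lt_of_lt_of_le hs' (min_le_left _ _)
          rw [Complex.dist_eq, hsz] at h1
          have habs := Complex.abs_re_le_norm (z + z - 1)
          rw [Complex.sub_re, hzz, Complex.one_re] at habs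
          norm_num at habs
          linarith
        · intro h
          have hs1 : s - 1 = z + z := by linear_combination h
          have h1 : dist s 1 < ‖z + z‖ := lt_of_lt_of_le hs' (min_le_right _ _)
          rw [Complex.dist_eq, hs1] at h1
          exact lt_irrefl _ h1
    refine ⟨σ₀, hσ₀, δ, hδpos,
      fun s => (s - 1) * G (s - (z + z)) / ((s - (z + z)) * (s - (z + z) - 1)), ?_, ?_, ?_⟩
    · intro s hs
      have hd : DifferentiableAt ℂ
          (fun s => (s - 1) * G (s - (z + z)) / ((s - (z + z)) * (s - (z + z) - 1))) s := by
        refine DifferentiableAt.div ?_ ?_ (hden s hs)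
        · exact (differentiableAt_id.sub_const 1).mul
            ((hG.comp (differentiable_id.sub_const (z + z))).differentiableAt)
        · exact (differentiableAt_id.sub_const (z + z)).mul
            ((differentiableAt_id.sub_const (z + z)).sub_const 1)
      exact hd.differentiableWithinAt
    · intro s hs
      have hs' : σ₀ < (s - (z + z)).re := by rwa [hre]
      have hmem : s ∈ {s : ℂ | 1 < s.re} ∪ Metric.ball 1 δ :=
        Or.inl (show 1 < s.re from lt_of_le_of_lt hσ₀ hs)
      have hne := hden s hmem
      show (s - 1) * G (s - (z + z)) / ((s - (z + z)) * (s - (z + z) - 1)) =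
        (s - 1) * partialAsaiL S c A η s
      rw [hGL _ hs', hshift, mul_div_assoc, mul_div_cancel_left₀ _ hne]
    · intro _
      simp

/-- **Grbac–Shahidi 2015, Thm. 4.3 at `s = 1` (the named fact
`GrbacShahidi2015_partialAsaiL_at_one`) from the HOLOMORPHY of the Asai `L`-functions in
`L²_cusp` (Thm. 4.3 (1), (2)(a)) and the `L²` facts of Jacquet–Shalika.** Hypotheses:

* `hGS` — Grbac–Shahidi 2015, Thm. 4.3 (1) and (2)(a), holomorphy clauses, for the partial Asai
  `L`-functions of BOTH signs of the cuspidal `Π₀ ≤ L²_cusp(GL_N(E) A_G \ GL_N(𝔸_E))` (the printed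
  normalisation), stated as in `CuspidalAutomorphicRepData.hol_of_asaiHolomorphyL2` — the statement
  requested as the cite item / named fact `GrbacShahidi2015_partialAsaiL_holomorphy`;
* `h22`, `h22'`, `h23`, `hm1` — the tree's NAMED FACTS `JacquetShalika1981_partialPairL_at_one_of_ne_conj`,
  `JacquetShalika1981_partialPairL_boundary_of_ne_one` (equal ranks, one measure),
  `JacquetShalika1981_partialPairL_pole_of_eq_conj` and `multiplicity_one_gl`, over every number
  field, in every rank, for every automorphic measure.

Proof: `GrbacShahidi2015_partialAsaiL_at_one_of_holomorphy_of_L2` with its hypothesis `hHol` supplied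
at every datum by `CuspidalAutomorphicRepData.hol_of_asaiHolomorphyL2`. This is the last paragraph of
Grbac–Shahidi's proof of Thm. 4.3 together with Remark 4.4 ("Once the holomorphy of the Asai and
twisted Asai `L`-function is known at some `s₀` with `Re(s₀) > 0`, the argument using the
Rankin–Selberg `L`-function … can be applied directly to obtain nonvanishing"), run for the partial
functions at `s₀ = 1`. [cite: GrbacShahidi2015, Thm. 4.3 and its proof, pp. 204–206, Remark 4.4]
[cite: ArthurClozelAMS120, Ch. 3 §2 (2.1)–(2.3)] [cite: BorelJacquetCorvallis1979, 4.6, 5.7] -/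
theorem GrbacShahidi2015_partialAsaiL_at_one_of_asaiHolomorphy_of_L2
    (hGS : ∀ (F E : Type) [Field F] [NumberField F] [Field E] [NumberField E] [Algebra F E]
      (c : E ≃ₐ[F] E), Module.finrank F E = 2 → c ≠ 1 →
      ∀ (N : ℕ) (μ : Measure (gl N E).automorphicQuotient) [(gl N E).IsAutomorphicMeasure μ]
        (P : CuspidalAutomorphicRepGL N E μ), 0 < N →
        ∀ (S : Set (HeightOneSpectrum (𝓞 F))) (A : SatakeFamily E) (η : ℤˣ), S.Finite →
          IsSatakeFamilyOf P {w : HeightOneSpectrum (𝓞 E) | w.under (𝓞 F) ∈ S} A →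
          (∀ w : HeightOneSpectrum (𝓞 E), w.under (𝓞 F) ∉ S → c • w = w →
            w.asIdeal.inertiaDeg (𝓞 F) = 2) →
          ∃ σ₀ : ℝ, 1 ≤ σ₀ ∧
            (∃ G : ℂ → ℂ, Differentiable ℂ G ∧
              ∀ s : ℂ, σ₀ < s.re → G s = s * (s - 1) * partialAsaiL S c A η s) ∧
            ((¬ ∀ᶠ w : HeightOneSpectrum (𝓞 E) in cofinite, A (c • w) = (A w).map (·⁻¹)) →
              ∃ H : ℂ → ℂ, Differentiable ℂ H ∧
                ∀ s : ℂ, σ₀ < s.re → H s = partialAsaiL S c A η s))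
    (h22 : ∀ (E : Type) [Field E] [NumberField E] (N : ℕ)
      (μ : Measure (gl N E).automorphicQuotient) [(gl N E).IsAutomorphicMeasure μ],
      JacquetShalika1981_partialPairL_at_one_of_ne_conj (n := N) (K := E) (μ := μ))
    (h22' : ∀ (E : Type) [Field E] [NumberField E] (N : ℕ)
      (μ : Measure (gl N E).automorphicQuotient) [(gl N E).IsAutomorphicMeasure μ],
      JacquetShalika1981_partialPairL_boundary_of_ne_one (n := N) (m := N) (K := E) (μ := μ)
        (μ' := μ))
    (h23 : ∀ (E : Type) [Field E] [NumberField E] (N : ℕ)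
      (μ : Measure (gl N E).automorphicQuotient) [(gl N E).IsAutomorphicMeasure μ],
      JacquetShalika1981_partialPairL_pole_of_eq_conj (n := N) (K := E) (μ := μ))
    (hm1 : ∀ (E : Type) [Field E] [NumberField E] (N : ℕ)
      (μ : Measure (gl N E).automorphicQuotient) [(gl N E).IsAutomorphicMeasure μ],
      multiplicity_one_gl N E μ) :
    GrbacShahidi2015_partialAsaiL_at_one :=
  GrbacShahidi2015_partialAsaiL_at_one_of_holomorphy_of_L2
    (fun _ _ _ _ _ _ _ _ h2 hc _ _ π hN hu _ _ η hSA =>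
      CuspidalAutomorphicRepData.hol_of_asaiHolomorphyL2 hGS h2 hc π hN hu η hSA)
    h22 h22' h23 hm1

end Reduction

/-! ### The weak form: holomorphy on a neighbourhood of `{1 ≤ Re s}` suffices -/

section ReGeOne

open AdelicGroupData

variable {F E : Type} [Field F] [NumberField F] [Field E] [NumberField E] [Algebra F E]

/-- **`hHol` at one datum from the WEAK form: holomorphy of `(s - 1) L^S(s, Π₀, As^η)` on a
neighbourhood of `{1 ≤ Re s}` in `L²_cusp`** (module docstring, item 4).  For a cuspidal Borel–Jacquet
datum `Π` on `GL_N(𝔸_E)` (`N ≥ 1`), unitary a.e., an Asai datum `(S, A)` and a sign `η`: granted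
`hGSw` — for every cuspidal `Π₀ ≤ L²_cusp(GL_N(E) A_G \ GL_N(𝔸_E))`, every finite `S`, every `L²`
Satake family `A'` of `Π₀` off `S_E` with the `c`-fixed places off `S` inert, and every sign, there are
`σ₀ ≥ 1`, an OPEN `U ⊇ {1 ≤ Re s}` and `G` holomorphic on `U` with `G = (s - 1) L^S(s, Π₀, As^η)` on
`{σ₀ < Re s}` and `G(1) = 0` unless `A'` is conjugate self-dual a.e. (Grbac–Shahidi 2015, Thm. 4.3
(1), (2)(a) for `Re(s) ≥ 1`, both signs; Remark 4.2, §4.A, §4.C; Flicker 1988 / Flicker–Zinoviev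
1995 for `As⁺`) — the function `(s - 1) L^S(s, Π, As^η)` continues holomorphically from some
`{σ₀ < Re s}` to `{1 < Re s} ∪ B(1, δ)`, with value `0` at `1` unless `Π` is conjugate self-dual a.e.
Proof: pointwise Borel–Jacquet dictionary `t_{Π,w} = q_w^z t_{Π₀,w}` (same `S`), `Re z = 0`,
`L^S(s, Π, As^η) = L^S(s - 2z, Π₀, As^η)`; if `z ≠ 0`, `G_Π(s) = (s - 1) G(s - 2z) / (s - 2z - 1)` on
`{1 < Re s} ∪ B(1, δ)`, `δ = min ε |2z|` with `B(1 - 2z, ε) ⊆ U` (the point `1 - 2z` lies on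
`Re s = 1`), `G_Π(1) = 0`; if `z = 0`, `G_Π = G` on `{1 < Re s} ∪ B(1, ε) ⊆ U` and `A' = A` is not
conjugate self-dual a.e. unless `Π` is (`hasSatakeParamAt_unique_holds`).
[cite: GrbacShahidi2015, Thm. 4.3 (1), (2)(a), Remark 4.2, §4.A p. 204, §4.C pp. 206–207]
[cite: FlickerZinoviev1995, Theorem] [cite: BorelJacquetCorvallis1979, 4.6, 5.7] -/
theorem CuspidalAutomorphicRepData.hol_of_asaiHolomorphyReGeOneL2
    (hGS : ∀ (F E : Type) [Field F] [NumberField F] [Field E] [NumberField E] [Algebra F E]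
      (c : E ≃ₐ[F] E), Module.finrank F E = 2 → c ≠ 1 →
      ∀ (N : ℕ) (μ : Measure (gl N E).automorphicQuotient) [(gl N E).IsAutomorphicMeasure μ]
        (P : CuspidalAutomorphicRepGL N E μ), 0 < N →
        ∀ (S : Set (HeightOneSpectrum (𝓞 F))) (A : SatakeFamily E) (η : ℤˣ), S.Finite →
          IsSatakeFamilyOf P {w : HeightOneSpectrum (𝓞 E) | w.under (𝓞 F) ∈ S} A →
          (∀ w : HeightOneSpectrum (𝓞 E), w.under (𝓞 F) ∉ S → c • w = w →
            w.asIdeal.inertiaDeg (𝓞 F) = 2) →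
          ∃ σ₀ : ℝ, 1 ≤ σ₀ ∧ ∃ U : Set ℂ, IsOpen U ∧ {s : ℂ | 1 ≤ s.re} ⊆ U ∧
            ∃ G : ℂ → ℂ, DifferentiableOn ℂ G U ∧
              (∀ s : ℂ, σ₀ < s.re → G s = (s - 1) * partialAsaiL S c A η s) ∧
              ((¬ ∀ᶠ w : HeightOneSpectrum (𝓞 E) in cofinite, A (c • w) = (A w).map (·⁻¹)) →
                G 1 = 0))
    (h2 : Module.finrank F E = 2) {c : E ≃ₐ[F] E} (hc : c ≠ 1) {N : ℕ}
    {hcpt : isCompact_glFiniteIntegralLevel N E} (π : CuspidalAutomorphicRepData N E hcpt)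
    (hN : 0 < N)
    (hu : ∀ᶠ w : HeightOneSpectrum (𝓞 E) in cofinite, ∀ α : Multiset ℂ,
      π.1.HasSatakeParamAt w α → ‖α.prod‖ = 1)
    {S : Set (HeightOneSpectrum (𝓞 F))} {A : SatakeFamily E} (η : ℤˣ)
    (hSA : π.1.IsAsaiDatum c S A) :
    ∃ σ₀ : ℝ, 1 ≤ σ₀ ∧ ∃ δ : ℝ, 0 < δ ∧ ∃ G : ℂ → ℂ,
      DifferentiableOn ℂ G ({s : ℂ | 1 < s.re} ∪ Metric.ball 1 δ) ∧
      (∀ s : ℂ, σ₀ < s.re → G s = (s - 1) * partialAsaiL S c A η s) ∧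
      (¬ π.1.IsConjSelfDualAE c → G 1 = 0) := by
  classical
  haveI : NeZero N := ⟨hN.ne'⟩
  haveI := infinite_heightOneSpectrum E
  obtain ⟨μ, hμ⟩ := AdelicGroupData.exists_isAutomorphicMeasure_gl_holds (n := N) (K := E)
  haveI := hμ
  -- Step 1: the pointwise Borel–Jacquet dictionary `t_{Π,w} = q_w^z t_{Π₀,w}` at every place
  obtain ⟨π₀, h0W', h0π⟩ :=
    CuspidalAutomorphicRepData.exists_clean_hasSatakeParamAt_iff_of_sSup_irreducible
      (AutomorphicRepsGL.stable_cuspidal_eq_sSup_irreducible_holds (hcpt := hcpt)) π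
  obtain ⟨z, P, S₁, αP, -, -, -, hdict⟩ :=
    CuspidalAutomorphicRepData.exists_satake_eq_cpow_mul_L2_pointwise
      (AutomorphicRepsGL.exists_isAssociatedL2_holds hcpt μ) (hasSatakeParamAt_iff_L2_holds hcpt μ)
      π π₀ h0W' h0π
  set SE : Set (HeightOneSpectrum (𝓞 E)) := {w | w.under (𝓞 F) ∈ S} with hSE
  have hSEfin : SE.Finite := finite_setOf_under_mem hSA.finite
  -- the shifted family `A' = q^{-z} A` is an `L²` Satake family of `Π₀` off `S_E`, for the SAME `S`
  set A' : SatakeFamily E := fun w => (A w).map (((w.residueCard : ℂ) ^ (-z)) * ·) with hA'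
  have hA'fam : IsSatakeFamilyOf P SE A' := by
    intro w hw
    obtain ⟨𝔫, ϖ, h𝔫, hw𝔫, hSat⟩ := (hdict w (A w)).mp (hSA.hasSatakeParamAt hw)
    exact ⟨𝔫, h𝔫, hw𝔫, ϖ, hSat⟩
  have hAA' : ∀ w : HeightOneSpectrum (𝓞 E), w.under (𝓞 F) ∉ S →
      A w = (A' w).map (((w.residueCard : ℂ) ^ z) * ·) := by
    intro w _
    simp only [hA', Multiset.map_map, Function.comp_def, residueCard_cpow_mul_cpow_neg_mul,
      Multiset.map_id']
  -- Step 2: `Re z = 0` by unitarity at one place outside `S_E`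
  have hz : z.re = 0 := by
    have hev : ∀ᶠ w : HeightOneSpectrum (𝓞 E) in cofinite, w ∉ SE := hSEfin.compl_mem_cofinite
    obtain ⟨w₀, hw₀u, hw₀⟩ := (hu.and hev).exists
    exact re_eq_zero_of_norm_prod_eq_one_of_shift hA'fam hN hw₀ (hAA' w₀ hw₀)
      (hw₀u (A w₀) (hSA.hasSatakeParamAt hw₀))
  have hzz : (z + z).re = 0 := by rw [Complex.add_re, hz, add_zero]
  have hre : ∀ s : ℂ, (s - (z + z)).re = s.re := fun s => by
    rw [Complex.sub_re, hzz, sub_zero]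
  -- the hypothesis at `(Π₀, S, A', η)` and the shift `L^S(s, Π, As^η) = L^S(s - 2z, Π₀, As^η)`
  have hinert : ∀ w : HeightOneSpectrum (𝓞 E), w.under (𝓞 F) ∉ S → c • w = w →
      w.asIdeal.inertiaDeg (𝓞 F) = 2 := fun w hw hcw => hSA.inertiaDeg_eq_two hw hcw
  obtain ⟨σ₀, hσ₀, U, hUo, hU1, G, hG, hGL, hnc⟩ :=
    hGS F E c h2 hc N μ P hN S A' η hSA.finite hA'fam hinert
  have hshift : partialAsaiL S c A η = fun s => partialAsaiL S c A' η (s - (z + z)) :=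
    partialAsaiL_eq_of_shift h2 hAA' hinert η
  -- a ball around the boundary point `1 - 2z ∈ {Re s = 1} ⊆ U`
  have h1zU : (1 : ℂ) - (z + z) ∈ U := hU1 (by
    show 1 ≤ ((1 : ℂ) - (z + z)).re
    rw [hre, Complex.one_re])
  obtain ⟨ε, hεpos, hεU⟩ := Metric.isOpen_iff.mp hUo _ h1zU
  -- Step 3: the explicit continuations
  by_cases hz0 : z + z = 0
  · -- `z = 0`: `G_Π = G` on `{1 < Re s} ∪ B(1, ε) ⊆ U`
    refine ⟨σ₀, hσ₀, ε, hεpos, G, hG.mono ?_, ?_, ?_⟩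
    · rintro s (hs | hs)
      · exact hU1 (show 1 ≤ s.re from le_of_lt hs)
      · apply hεU
        simpa only [hz0, sub_zero] using hs
    · intro s hs
      rw [hGL s hs, hshift, hz0]
      simp only [sub_zero]
    · intro hπ
      have hz' : z = 0 := add_self_eq_zero.mp hz0
      have hA'A : ∀ w, A' w = A w := fun w => by
        simp only [hA', hz', neg_zero, Complex.cpow_zero, one_mul, Multiset.map_id']
      -- `A'` is not conjugate self-dual a.e., since `Π` is not
      refine hnc fun hcsd => hπ ?_
      have hev : ∀ᶠ w : HeightOneSpectrum (𝓞 E) in cofinite, w ∉ SE := hSEfin.compl_mem_cofinite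
      filter_upwards [hcsd, hev] with w hw hwS α β hα hβ
      have hcwS : (c • w).under (𝓞 F) ∉ S := by
        rw [HeightOneSpectrum.under_algEquiv_smul F E c w]
        exact hwS
      rw [π.1.hasSatakeParamAt_unique_holds hα (hSA.hasSatakeParamAt hwS),
        π.1.hasSatakeParamAt_unique_holds hβ (hSA.hasSatakeParamAt hcwS), ← hA'A w,
        ← hA'A (c • w)]
      exact hw
  · -- `z ≠ 0`: `G_Π(s) = (s - 1) G(s - 2z) / (s - 2z - 1)`, `δ = min ε |2z|`
    set δ : ℝ := min ε ‖z + z‖ with hδ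
    have hδpos : 0 < δ := lt_min hεpos (norm_pos_iff.mpr hz0)
    -- the denominator does not vanish on `{1 < Re s} ∪ B(1, δ)`, and `s - 2z ∈ U` there
    have hden : ∀ s : ℂ, s ∈ {s : ℂ | 1 < s.re} ∪ Metric.ball 1 δ → s - (z + z) - 1 ≠ 0 := by
      rintro s (hs | hs) h
      · have hs' : 1 < s.re := hs
        have := congrArg Complex.re h
        rw [Complex.sub_re, hre, Complex.one_re, Complex.zero_re] at this
        linarith
      · have hs' : dist s 1 < δ := hs
        have hs1 : s - 1 = z + z := by linear_combination h
        have h1 : dist s 1 < ‖z + z‖ := lt_of_lt_of_le hs' (min_le_right _ _)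
        rw [Complex.dist_eq, hs1] at h1
        exact lt_irrefl _ h1
    have hmemU : ∀ s : ℂ, s ∈ {s : ℂ | 1 < s.re} ∪ Metric.ball 1 δ → s - (z + z) ∈ U := by
      rintro s (hs | hs)
      · apply hU1
        show 1 ≤ (s - (z + z)).re
        rw [hre]
        exact le_of_lt hs
      · apply hεU
        have hs' : dist s 1 < ε := lt_of_lt_of_le hs (min_le_left _ _)
        rw [Metric.mem_ball, Complex.dist_eq]
        rw [Complex.dist_eq] at hs'
        convert hs' using 2
        ring
    refine ⟨σ₀, hσ₀, δ, hδpos, fun s => (s - 1) * G (s - (z + z)) / (s - (z + z) - 1), ?_, ?_, ?_⟩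
    · intro s hs
      have hGat : DifferentiableAt ℂ G (s - (z + z)) :=
        hG.differentiableAt (hUo.mem_nhds (hmemU s hs))
      have hd : DifferentiableAt ℂ
          (fun s => (s - 1) * G (s - (z + z)) / (s - (z + z) - 1)) s := by
        refine DifferentiableAt.div ?_ ?_ (hden s hs)
        · exact (differentiableAt_id.sub_const 1).mul
            (hGat.comp s (differentiableAt_id.sub_const (z + z)))
        · exact (differentiableAt_id.sub_const (z + z)).sub_const 1
      exact hd.differentiableWithinAt
    · intro s hs
      have hs' : σ₀ < (s - (z + z)).re := by rwa [hre]
      have hmem : s ∈ {s : ℂ | 1 < s.re} ∪ Metric.ball 1 δ :=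
        Or.inl (show 1 < s.re from lt_of_le_of_lt hσ₀ hs)
      have hne := hden s hmem
      show (s - 1) * G (s - (z + z)) / (s - (z + z) - 1) = (s - 1) * partialAsaiL S c A η s
      rw [hGL _ hs', hshift, mul_div_assoc, mul_div_cancel_left₀ _ hne]
    · intro _
      simp

/-- **The strong form implies the weak form.**  If `s (s - 1) L^S(s, Π₀, As^η)` is the restriction
of an ENTIRE `G` (and `L^S` that of an entire `H` unless the family is conjugate self-dual a.e.) —
Grbac–Shahidi's Thm. 4.3 (1), (2)(a) on all of `ℂ`, the hypothesis `hGS` of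
`GrbacShahidi2015_partialAsaiL_at_one_of_asaiHolomorphy_of_L2` — then `G / s` is holomorphic on the open
neighbourhood `ℂ ∖ {0}` of `{1 ≤ Re s}`, equals `(s - 1) L^S` far to the right, and vanishes at `1` in
the non-conjugate-self-dual case (`G = s (s - 1) H` identically, by the identity theorem).
[cite: GrbacShahidi2015, Thm. 4.3 (1), (2)(a)] -/
theorem asaiHolomorphyReGeOne_of_asaiHolomorphy
    (hGS : ∀ (F E : Type) [Field F] [NumberField F] [Field E] [NumberField E] [Algebra F E]
      (c : E ≃ₐ[F] E), Module.finrank F E = 2 → c ≠ 1 →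
      ∀ (N : ℕ) (μ : Measure (gl N E).automorphicQuotient) [(gl N E).IsAutomorphicMeasure μ]
        (P : CuspidalAutomorphicRepGL N E μ), 0 < N →
        ∀ (S : Set (HeightOneSpectrum (𝓞 F))) (A : SatakeFamily E) (η : ℤˣ), S.Finite →
          IsSatakeFamilyOf P {w : HeightOneSpectrum (𝓞 E) | w.under (𝓞 F) ∈ S} A →
          (∀ w : HeightOneSpectrum (𝓞 E), w.under (𝓞 F) ∉ S → c • w = w →
            w.asIdeal.inertiaDeg (𝓞 F) = 2) →
          ∃ σ₀ : ℝ, 1 ≤ σ₀ ∧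
            (∃ G : ℂ → ℂ, Differentiable ℂ G ∧
              ∀ s : ℂ, σ₀ < s.re → G s = s * (s - 1) * partialAsaiL S c A η s) ∧
            ((¬ ∀ᶠ w : HeightOneSpectrum (𝓞 E) in cofinite, A (c • w) = (A w).map (·⁻¹)) →
              ∃ H : ℂ → ℂ, Differentiable ℂ H ∧
                ∀ s : ℂ, σ₀ < s.re → H s = partialAsaiL S c A η s))
    (F E : Type) [Field F] [NumberField F] [Field E] [NumberField E] [Algebra F E]
    (c : E ≃ₐ[F] E) (h2 : Module.finrank F E = 2) (hc : c ≠ 1)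
    (N : ℕ) (μ : Measure (gl N E).automorphicQuotient) [(gl N E).IsAutomorphicMeasure μ]
    (P : CuspidalAutomorphicRepGL N E μ) (hN : 0 < N)
    (S : Set (HeightOneSpectrum (𝓞 F))) (A : SatakeFamily E) (η : ℤˣ) (hS : S.Finite)
    (hA : IsSatakeFamilyOf P {w : HeightOneSpectrum (𝓞 E) | w.under (𝓞 F) ∈ S} A)
    (hinert : ∀ w : HeightOneSpectrum (𝓞 E), w.under (𝓞 F) ∉ S → c • w = w →
      w.asIdeal.inertiaDeg (𝓞 F) = 2) :
    ∃ σ₀ : ℝ, 1 ≤ σ₀ ∧ ∃ U : Set ℂ, IsOpen U ∧ {s : ℂ | 1 ≤ s.re} ⊆ U ∧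
      ∃ G : ℂ → ℂ, DifferentiableOn ℂ G U ∧
        (∀ s : ℂ, σ₀ < s.re → G s = (s - 1) * partialAsaiL S c A η s) ∧
        ((¬ ∀ᶠ w : HeightOneSpectrum (𝓞 E) in cofinite, A (c • w) = (A w).map (·⁻¹)) →
          G 1 = 0) := by
  obtain ⟨σ₀, hσ₀, ⟨G, hG, hGL⟩, hnc⟩ := hGS F E c h2 hc N μ P hN S A η hS hA hinert
  refine ⟨σ₀, hσ₀, {s : ℂ | s ≠ 0}, isOpen_ne, ?_, fun s => G s / s, ?_, ?_, ?_⟩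
  · intro s hs h0
    have hs' : 1 ≤ s.re := hs
    rw [show s = 0 from h0, Complex.zero_re] at hs'
    linarith
  · intro s hs
    exact ((hG s).div differentiableAt_id hs).differentiableWithinAt
  · intro s hs
    have hs0 : s ≠ 0 := by
      intro h
      rw [h, Complex.zero_re] at hs
      linarith
    show G s / s = (s - 1) * partialAsaiL S c A η s
    rw [hGL s hs, mul_assoc, mul_div_cancel_left₀ _ hs0]
  · intro hncsd
    obtain ⟨H, hH, hHL⟩ := hnc hncsd
    have hGH : G = fun s => s * (s - 1) * H s :=
      eq_of_differentiable_of_eq_on_lt_re hG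
        ((differentiable_id.mul (differentiable_id.sub_const 1)).mul hH)
        (fun s hs => by rw [hGL s hs, hHL s hs])
    show G 1 / 1 = 0
    rw [hGH]
    simp

/-- **Grbac–Shahidi 2015, Thm. 4.3 at `s = 1` (the named fact `GrbacShahidi2015_partialAsaiL_at_one`)
from the holomorphy of the Asai `L`-functions on `Re(s) ≥ 1` ONLY, in `L²_cusp`, and the `L²` facts of
Jacquet–Shalika.**  Hypotheses:

* `hGSw` — for the cuspidal `Π₀ ≤ L²_cusp(GL_N(E) A_G \ GL_N(𝔸_E))` (the printed normalisation,
  §2.A p. 190), every finite `S`, every `L²` Satake family off `S_E` (the `c`-fixed places off `S`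
  inert) and BOTH signs `η`: `(s - 1) L^S(s, Π₀, As^η)` is, on some `{σ₀ < Re s}`, the restriction of
  a function holomorphic on an open neighbourhood of the closed half-plane `{1 ≤ Re s}`, vanishing at
  `s = 1` unless the family is conjugate self-dual a.e. — Grbac–Shahidi 2015, Thm. 4.3 (1) ("If `σ`
  is not Galois self-dual … `L(s, σ, r_A)` is entire") and (2)(a) ("entire, except for possible
  simple poles at `s = 0` and `s = 1`") RESTRICTED to `Re(s) ≥ 1`, for `r_A` and for
  `r_A ⊗ δ_{E/F}` (`L(s, σ, r_A ⊗ δ_{E/F}) = L(s, σ ⊗ δ̂, r_A)`, p. 206), in partial form (the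
  finitely many reciprocal local factors are entire); by Remark 4.2, §4.A and §4.C this part of the
  theorem does not depend on the endoscopic classification, and for `As⁺` it is also Flicker's
  theorem (Flicker 1988, p. 297; Flicker–Zinoviev 1995).  This is the statement requested as the
  named fact `GrbacShahidi2015_partialAsaiL_holomorphy_re_ge_one` (a proving seat may not file a new
  named fact, D-0026; the statement is `hGSw` verbatim);
* `h22`, `h22'`, `h23`, `hm1` — the tree's NAMED FACTS `JacquetShalika1981_partialPairL_at_one_of_ne_conj`,
  `JacquetShalika1981_partialPairL_boundary_of_ne_one` (equal ranks, one measure),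
  `JacquetShalika1981_partialPairL_pole_of_eq_conj` and `multiplicity_one_gl`, over every number
  field, in every rank, for every automorphic measure.

Proof: `GrbacShahidi2015_partialAsaiL_at_one_of_holomorphy_of_L2` with `hHol` supplied at every datum by
`CuspidalAutomorphicRepData.hol_of_asaiHolomorphyReGeOneL2` — Grbac–Shahidi's Remark 4.4 ("Once the
holomorphy of the Asai and twisted Asai `L`-function is known at some `s₀` with `Re(s₀) > 0`, the
argument using the Rankin–Selberg `L`-function … can be applied directly to obtain nonvanishing") run
for the partial functions at `s₀ = 1`.  The strong form gives this one back through
`asaiHolomorphyReGeOne_of_asaiHolomorphy`.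
[cite: GrbacShahidi2015, Thm. 4.3 and its proof, pp. 204–206, Remarks 4.2, 4.4, §4.C]
[cite: FlickerZinoviev1995, Theorem] [cite: ArthurClozelAMS120, Ch. 3 §2 (2.1)–(2.3)]
[cite: BorelJacquetCorvallis1979, 4.6, 5.7] -/
theorem GrbacShahidi2015_partialAsaiL_at_one_of_asaiHolomorphyReGeOne_of_L2
    (hGS : ∀ (F E : Type) [Field F] [NumberField F] [Field E] [NumberField E] [Algebra F E]
      (c : E ≃ₐ[F] E), Module.finrank F E = 2 → c ≠ 1 →
      ∀ (N : ℕ) (μ : Measure (gl N E).automorphicQuotient) [(gl N E).IsAutomorphicMeasure μ]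
        (P : CuspidalAutomorphicRepGL N E μ), 0 < N →
        ∀ (S : Set (HeightOneSpectrum (𝓞 F))) (A : SatakeFamily E) (η : ℤˣ), S.Finite →
          IsSatakeFamilyOf P {w : HeightOneSpectrum (𝓞 E) | w.under (𝓞 F) ∈ S} A →
          (∀ w : HeightOneSpectrum (𝓞 E), w.under (𝓞 F) ∉ S → c • w = w →
            w.asIdeal.inertiaDeg (𝓞 F) = 2) →
          ∃ σ₀ : ℝ, 1 ≤ σ₀ ∧ ∃ U : Set ℂ, IsOpen U ∧ {s : ℂ | 1 ≤ s.re} ⊆ U ∧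
            ∃ G : ℂ → ℂ, DifferentiableOn ℂ G U ∧
              (∀ s : ℂ, σ₀ < s.re → G s = (s - 1) * partialAsaiL S c A η s) ∧
              ((¬ ∀ᶠ w : HeightOneSpectrum (𝓞 E) in cofinite, A (c • w) = (A w).map (·⁻¹)) →
                G 1 = 0))
    (h22 : ∀ (E : Type) [Field E] [NumberField E] (N : ℕ)
      (μ : Measure (gl N E).automorphicQuotient) [(gl N E).IsAutomorphicMeasure μ],
      JacquetShalika1981_partialPairL_at_one_of_ne_conj (n := N) (K := E) (μ := μ))
    (h22' : ∀ (E : Type) [Field E] [NumberField E] (N : ℕ)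
      (μ : Measure (gl N E).automorphicQuotient) [(gl N E).IsAutomorphicMeasure μ],
      JacquetShalika1981_partialPairL_boundary_of_ne_one (n := N) (m := N) (K := E) (μ := μ)
        (μ' := μ))
    (h23 : ∀ (E : Type) [Field E] [NumberField E] (N : ℕ)
      (μ : Measure (gl N E).automorphicQuotient) [(gl N E).IsAutomorphicMeasure μ],
      JacquetShalika1981_partialPairL_pole_of_eq_conj (n := N) (K := E) (μ := μ))
    (hm1 : ∀ (E : Type) [Field E] [NumberField E] (N : ℕ)
      (μ : Measure (gl N E).automorphicQuotient) [(gl N E).IsAutomorphicMeasure μ],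
      multiplicity_one_gl N E μ) :
    GrbacShahidi2015_partialAsaiL_at_one :=
  GrbacShahidi2015_partialAsaiL_at_one_of_holomorphy_of_L2
    (fun _ _ _ _ _ _ _ _ h2 hc _ _ π hN hu _ _ η hSA =>
      CuspidalAutomorphicRepData.hol_of_asaiHolomorphyReGeOneL2 hGS h2 hc π hN hu η hSA)
    h22 h22' h23 hm1

/-- Consistency: the strong-form theorem `GrbacShahidi2015_partialAsaiL_at_one_of_asaiHolomorphy_of_L2`
re-derived through the weak form. [folklore] -/
example
    (hGS : ∀ (F E : Type) [Field F] [NumberField F] [Field E] [NumberField E] [Algebra F E]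
      (c : E ≃ₐ[F] E), Module.finrank F E = 2 → c ≠ 1 →
      ∀ (N : ℕ) (μ : Measure (gl N E).automorphicQuotient) [(gl N E).IsAutomorphicMeasure μ]
        (P : CuspidalAutomorphicRepGL N E μ), 0 < N →
        ∀ (S : Set (HeightOneSpectrum (𝓞 F))) (A : SatakeFamily E) (η : ℤˣ), S.Finite →
          IsSatakeFamilyOf P {w : HeightOneSpectrum (𝓞 E) | w.under (𝓞 F) ∈ S} A →
          (∀ w : HeightOneSpectrum (𝓞 E), w.under (𝓞 F) ∉ S → c • w = w →
            w.asIdeal.inertiaDeg (𝓞 F) = 2) →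
          ∃ σ₀ : ℝ, 1 ≤ σ₀ ∧
            (∃ G : ℂ → ℂ, Differentiable ℂ G ∧
              ∀ s : ℂ, σ₀ < s.re → G s = s * (s - 1) * partialAsaiL S c A η s) ∧
            ((¬ ∀ᶠ w : HeightOneSpectrum (𝓞 E) in cofinite, A (c • w) = (A w).map (·⁻¹)) →
              ∃ H : ℂ → ℂ, Differentiable ℂ H ∧
                ∀ s : ℂ, σ₀ < s.re → H s = partialAsaiL S c A η s))
    (h22 : ∀ (E : Type) [Field E] [NumberField E] (N : ℕ)
      (μ : Measure (gl N E).automorphicQuotient) [(gl N E).IsAutomorphicMeasure μ],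
      JacquetShalika1981_partialPairL_at_one_of_ne_conj (n := N) (K := E) (μ := μ))
    (h22' : ∀ (E : Type) [Field E] [NumberField E] (N : ℕ)
      (μ : Measure (gl N E).automorphicQuotient) [(gl N E).IsAutomorphicMeasure μ],
      JacquetShalika1981_partialPairL_boundary_of_ne_one (n := N) (m := N) (K := E) (μ := μ)
        (μ' := μ))
    (h23 : ∀ (E : Type) [Field E] [NumberField E] (N : ℕ)
      (μ : Measure (gl N E).automorphicQuotient) [(gl N E).IsAutomorphicMeasure μ],
      JacquetShalika1981_partialPairL_pole_of_eq_conj (n := N) (K := E) (μ := μ))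
    (hm1 : ∀ (E : Type) [Field E] [NumberField E] (N : ℕ)
      (μ : Measure (gl N E).automorphicQuotient) [(gl N E).IsAutomorphicMeasure μ],
      multiplicity_one_gl N E μ) :
    GrbacShahidi2015_partialAsaiL_at_one :=
  GrbacShahidi2015_partialAsaiL_at_one_of_asaiHolomorphyReGeOne_of_L2
    (fun F E _ _ _ _ _ c h2 hc N μ _ P hN S A η hS hA hinert =>
      asaiHolomorphyReGeOne_of_asaiHolomorphy hGS F E c h2 hc N μ P hN S A η hS hA hinert)
    h22 h22' h23 hm1

end ReGeOne

end Literature.NumberTheory.Automorphic
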